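import Mathlib
import Summits.NavierStokesRegularity.NavierStokesRegularity.Theorems.FilamentSkeletonRssStadiumQuarterFootTail
import Summits.NavierStokesRegularity.NavierStokesRegularity.Theorems.FilamentSkeletonRssStadiumQuarterFootTailLeft
import Summits.NavierStokesRegularity.NavierStokesRegularity.Theorems.FilamentSkeletonRssStadiumFrozenRealPiece
import Summits.NavierStokesRegularity.NavierStokesRegularity.Theorems.FilamentSkeletonRssStadiumRealKernelIntegrable
import Summits.NavierStokesRegularity.NavierStokesRegularity.Theorems.FilamentSkeletonRssStadiumHalfLineGlue
import Summits.NavierStokesRegularity.NavierStokesRegularity.Theorems.FilamentSkeletonRssStadiumFarMajorant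

/-!
# Route `FilamentSkeletonRss` · cruxes `SkeletonJ1L` (stmt-NavierStokesRegularity-23296, registered stub `stub_tangentSkeletonL` ≡
# `TangentSkeletonNearStraightL`, stmt-23320) · line `child_tangent_analytic_strip_L` (b0b56c52900dd90a), stub `stub_stripPropagation` —
# brick for `rcore`: THE FROZEN FEET OF THE QUARTER-WIDTH TENT NEAR AN ANCHOR (the `hfeet` / `hint` inputs of the tent freeze)

For an anchor `z₀` of the quarter stadium (`|Im z₀| < hs/4`, `|Re z₀ − cc| < L + hs/4`) with feet at `Re z₀ ± hs/2`:
* `quarter_right_foot_frozen` — on a ball `B(z₀, δ)`: the frozen right foot `z ↦ ∫_{σ > Re z₀ + hs/2} g_z σ dσ` is holomorphic, and for every target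
  `z` of the ball the real-source kernel `g_z` is integrable on the frozen foot `Ioi (Re z₀ + hs/2)` AND on its own foot `Ioi (Re z + hs/2)`;
* `quarter_left_foot_frozen` — the same for `Iic (Re z₀ − hs/2)` / `Iic (Re z − hs/2)`.
Assembly of landed pieces only: positivity at the anchor on the compact part from `Theorems.StadiumQuarterFootTail(Left).quarter_foot_re_ge(_left)`,
persistence + holomorphy of the compact part `Theorems.StadiumFrozenRealPiece`, tails `Theorems.StadiumQuarterFootTail(Left).quarter_foot_tail(_left)`,
integrability `Theorems.StadiumRealKernelIntegrable`, glue `Theorems.StadiumHalfLineGlue`.  These are the `hfeet` and (feet part of) `hint`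
hypotheses of `Theorems.StadiumTentFreezeNhds.tent_eq_frozen_nhds_sharp` with `r z = Re z + hs/2`, `ℓ z = Re z − hs/2` — IF the tent's feet are
placed there (the blueprint's left foot sits further left, behind the long plateau; the right foot is this one).
HONEST FRAMING: bookkeeping for a HYPOTHETICAL filament skeleton on the NEGATIVE side of a MODEL route; the stub `stub_stripPropagation` is NOT closed
by this file, `TangentSkeletonNearStraightL` / `SkeletonJ1L` stay OPEN; nothing here bears on Navier–Stokes regularity or blow-up.
`--supports stmt-NavierStokesRegularity-23320` (≡ stub `stub_tangentSkeletonL` of 23296).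
-/

set_option linter.dupNamespace false

noncomputable section

namespace Summit.NavierStokesRegularity.NavierStokesRegularity.Theorems.StadiumQuarterFeetFrozen

open Set Filter Topology Complex MeasureTheory Metric
open scoped InnerProductSpace Matrix
open Summit.NavierStokesRegularity.NavierStokesRegularity.Theorems.StadiumQuarterFootTail
open Summit.NavierStokesRegularity.NavierStokesRegularity.Theorems.StadiumQuarterFootTailLeft
open Summit.NavierStokesRegularity.NavierStokesRegularity.Theorems.StadiumFrozenRealPiece
open Summit.NavierStokesRegularity.NavierStokesRegularity.Theorems.StadiumRealKernelIntegrable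
open Summit.NavierStokesRegularity.NavierStokesRegularity.Theorems.StadiumHalfLineGlue
open Summit.NavierStokesRegularity.NavierStokesRegularity.Theorems.StadiumFarMajorant
open Summit.NavierStokesRegularity.NavierStokesRegularity.Theorems.StadiumPartnerPiece

/-- **The frozen RIGHT foot near an anchor of the quarter stadium.**  See the module docstring. [folklore] -/
theorem quarter_right_foot_frozen {hs L cc κ : ℝ} {F : ℂ → (Fin 3 → ℂ)}
    (hF : DifferentiableOn ℂ F {z : ℂ | |z.im| < hs ∧ |z.re - cc| < L + hs})
    (hM : ∀ z ∈ {z : ℂ | |z.im| < hs ∧ |z.re - cc| < L + hs}, ‖deriv F z‖ ≤ 2)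
    (hunit : ∀ w ∈ {z : ℂ | |z.im| < hs ∧ |z.re - cc| < L + hs}, ∑ i, (deriv F w i) ^ 2 = 1)
    {X : ℝ → EuclideanSpace ℝ (Fin 3)} (hX : ContDiff ℝ 1 X) (hXu : ∀ τ, ‖deriv X τ‖ = 1)
    {Rb : ℝ} (hRb0 : 0 ≤ Rb) (hRb : Rb ≤ 1 / 2) (hosc : ∀ τ σ, ‖deriv X τ - deriv X σ‖ ≤ Rb)
    (hFX : ∀ r : ℝ, (r : ℂ) ∈ {z : ℂ | |z.im| < hs ∧ |z.re - cc| < L + hs} →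
      F r = fun i => ((⟪X r, EuclideanSpace.single i (1:ℝ)⟫_ℝ : ℝ) : ℂ))
    {A : ℝ → ℝ} (hAc : Continuous A) (hA : ∀ σ, 0 ≤ A σ) (hκ : 0 ≤ κ) (hhs : 0 < hs)
    {z₀ : ℂ} (hz₀im : |z₀.im| < hs / 4) (hz₀re : |z₀.re - cc| < L + hs / 4) :
    ∃ δ : ℝ, 0 < δ ∧
      DifferentiableOn ℂ (fun z => ∫ σ in Ioi (z₀.re + hs / 2),
        (((∑ i, (F z i - ((X σ i : ℝ) : ℂ)) ^ 2) + ((κ * A σ : ℝ) : ℂ)) ^ ((3:ℂ) / 2))⁻¹ •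
          ((fun i => ((deriv X σ i : ℝ) : ℂ)) ⨯₃ (fun i => F z i - ((X σ i : ℝ) : ℂ)))) (ball z₀ δ) ∧
      ∀ z ∈ ball z₀ δ,
        IntegrableOn (fun σ => (((∑ i, (F z i - ((X σ i : ℝ) : ℂ)) ^ 2) + ((κ * A σ : ℝ) : ℂ)) ^ ((3:ℂ) / 2))⁻¹ •
          ((fun i => ((deriv X σ i : ℝ) : ℂ)) ⨯₃ (fun i => F z i - ((X σ i : ℝ) : ℂ)))) (Ioi (z₀.re + hs / 2)) ∧
        IntegrableOn (fun σ => (((∑ i, (F z i - ((X σ i : ℝ) : ℂ)) ^ 2) + ((κ * A σ : ℝ) : ℂ)) ^ ((3:ℂ) / 2))⁻¹ •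
          ((fun i => ((deriv X σ i : ℝ) : ℂ)) ⨯₃ (fun i => F z i - ((X σ i : ℝ) : ℂ)))) (Ioi (z.re + hs / 2)) := by
  set S : Set ℂ := {z : ℂ | |z.im| < hs ∧ |z.re - cc| < L + hs} with hS
  set x₀ : ℝ := z₀.re with hx₀
  set K : ℂ → ℝ → (Fin 3 → ℂ) := fun z σ => (((∑ i, (F z i - ((X σ i : ℝ) : ℂ)) ^ 2) + ((κ * A σ : ℝ) : ℂ)) ^ ((3:ℂ) / 2))⁻¹ •
      ((fun i => ((deriv X σ i : ℝ) : ℂ)) ⨯₃ (fun i => F z i - ((X σ i : ℝ) : ℂ))) with hK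
  have hz₀S : z₀ ∈ S := ⟨by linarith, by linarith⟩
  -- the target box of the tails and a ball inside it
  set B : Set ℂ := {z : ℂ | |z.im| < hs / 4 ∧ |z.re - cc| < L + hs / 4} ∩ {z : ℂ | |z.im| < hs / 4 ∧ |z.re - x₀| < hs / 2}
    with hB
  have hBo : IsOpen B := (isOpen_stadium (hs / 4) (L + hs / 4) cc).inter (isOpen_stadium (hs / 4) (hs / 2) x₀)
  have hz₀B : z₀ ∈ B := ⟨⟨hz₀im, hz₀re⟩, ⟨hz₀im, by simp [hx₀, hhs]⟩⟩
  obtain ⟨ε, hε, hεB⟩ := Metric.isOpen_iff.mp hBo z₀ hz₀B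
  -- positivity at the anchor on the compact part `[x₀ + hs/2, x₀ + hs]`
  have hposA : ∀ σ ∈ Icc (x₀ + hs / 2) (x₀ + hs),
      0 < ((∑ i, (F z₀ i - ((X σ i : ℝ) : ℂ)) ^ 2) + ((κ * A σ : ℝ) : ℂ)).re := by
    intro σ hσ
    have h := quarter_foot_re_ge hF hM hunit hX hXu hRb0 hRb hosc hFX hhs hz₀im hz₀re (σ := σ) (by rw [← hx₀]; linarith [hσ.1])
    rw [Complex.add_re, Complex.ofReal_re]
    have hp : 0 < σ - z₀.re := by rw [← hx₀]; linarith [hσ.1]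
    have h2 : 0 < (σ - z₀.re) ^ 2 / 4 := by positivity
    nlinarith [mul_nonneg hκ (hA σ)]
  -- the frozen compact part
  obtain ⟨μ, δ₁, R₁, hμ, hδ₁, -, hball₁, hmargin, -, hdiffc, -⟩ :=
    frozenRealPiece_nhds hF hM zero_le_two hX hXu hAc hz₀S (a := x₀ + hs / 2) (b := x₀ + hs) (by linarith) hposA
  -- the tail on the box
  obtain ⟨hdifft, -⟩ := quarter_foot_tail hF hM hunit hX hXu hRb0 hRb hosc hFX hAc hA hκ hhs x₀
  -- the radius
  set δ : ℝ := min δ₁ ε with hδ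
  have hδpos : 0 < δ := lt_min hδ₁ hε
  have hV₁ : ball z₀ δ ⊆ ball z₀ δ₁ := ball_subset_ball (min_le_left _ _)
  have hVB : ball z₀ δ ⊆ B := (ball_subset_ball (min_le_right _ _)).trans hεB
  -- integrability of the two pieces for the targets of the ball
  have hLor : Integrable (fun σ : ℝ => 1280 * ((1:ℝ) ^ 2 * (σ - x₀) ^ 2 + hs ^ 2)⁻¹) :=
    (integrable_lorentzian hhs one_ne_zero x₀).const_mul _
  have htailint : ∀ z ∈ B, IntegrableOn (K z) (Ioi (x₀ + hs)) := by
    intro z hz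
    have hk : ∀ σ ∈ Ioi (x₀ + hs), (σ - x₀) ^ 2 / 16 ≤ ((∑ i, (F z i - ((X σ i : ℝ) : ℂ)) ^ 2) + ((κ * A σ : ℝ) : ℂ)).re ∧
        ‖K z σ‖ ≤ 1280 * ((1:ℝ) ^ 2 * (σ - x₀) ^ 2 + hs ^ 2)⁻¹ :=
      fun σ hσ => quarter_foot_kernel_le hF hM hunit hX hXu hRb0 hRb hosc hFX hA hκ hhs hz.1.1 hz.1.2 hz.2.2 (le_of_lt hσ)
    refine realKernel_integrableOn_of_bound hX hAc z measurableSet_Ioi (fun σ hσ => ?_) hLor.integrableOn (fun σ hσ => (hk σ hσ).2)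
    have h := (hk σ hσ).1
    have hσ' : x₀ + hs < σ := hσ
    have hp : 0 < σ - x₀ := by linarith
    have : 0 < (σ - x₀) ^ 2 / 16 := by positivity
    linarith
  have hint : ∀ z ∈ ball z₀ δ, IntegrableOn (K z) (Icc (x₀ + hs / 2) (x₀ + hs)) ∧ IntegrableOn (K z) (Ioi (x₀ + hs)) := by
    intro z hz
    refine ⟨realKernel_integrableOn_Icc hX hAc z fun σ hσ => lt_of_lt_of_le hμ (hmargin z (hV₁ hz) σ hσ), htailint z (hVB hz)⟩
  have hdifft' : DifferentiableOn ℂ (fun z => ∫ σ in Ioi (x₀ + hs), K z σ) (ball z₀ δ) :=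
    (hdifft.mono hVB).congr fun z _ => integral_Ici_eq_integral_Ioi.symm
  obtain ⟨hsplit, hdiff⟩ := halfline_right_glue (g := K) (V := ball z₀ δ) (by linarith : x₀ + hs / 2 ≤ x₀ + hs) hint
    (hdiffc.mono hV₁) hdifft'
  refine ⟨δ, hδpos, hdiff, fun z hz => ⟨(hsplit z hz).1, ?_⟩⟩
  -- the target's own foot `Ioi (Re z + hs/2)`: compact part certified at the target, tail as above
  have hzB := hVB hz
  have hzx : |z.re - x₀| < hs / 2 := hzB.2.2
  have hzx' := abs_lt.mp hzx
  have hposz : ∀ σ ∈ Icc (z.re + hs / 2) (x₀ + hs),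
      0 < ((∑ i, (F z i - ((X σ i : ℝ) : ℂ)) ^ 2) + ((κ * A σ : ℝ) : ℂ)).re := by
    intro σ hσ
    have h := quarter_foot_re_ge hF hM hunit hX hXu hRb0 hRb hosc hFX hhs hzB.1.1 hzB.1.2 (σ := σ) (by linarith [hσ.1])
    rw [Complex.add_re, Complex.ofReal_re]
    have hp : 0 < σ - z.re := by linarith [hσ.1]
    have h2 : 0 < (σ - z.re) ^ 2 / 4 := by positivity
    nlinarith [mul_nonneg hκ (hA σ)]
  have h1 : IntegrableOn (K z) (Ioc (z.re + hs / 2) (x₀ + hs)) :=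
    (realKernel_integrableOn_Icc hX hAc z hposz).mono_set Ioc_subset_Icc_self
  have h2 := htailint z hzB
  rw [← Ioc_union_Ioi_eq_Ioi (by linarith : z.re + hs / 2 ≤ x₀ + hs)]
  exact h1.union h2

/-- **The frozen LEFT foot near an anchor of the quarter stadium** (mirror of `quarter_right_foot_frozen`: compact part `[x₀ − hs, x₀ − hs/2]`,
tail `σ ≤ x₀ − hs`, own foot `Iic (Re z − hs/2)`). [folklore] -/
theorem quarter_left_foot_frozen {hs L cc κ : ℝ} {F : ℂ → (Fin 3 → ℂ)}
    (hF : DifferentiableOn ℂ F {z : ℂ | |z.im| < hs ∧ |z.re - cc| < L + hs})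
    (hM : ∀ z ∈ {z : ℂ | |z.im| < hs ∧ |z.re - cc| < L + hs}, ‖deriv F z‖ ≤ 2)
    (hunit : ∀ w ∈ {z : ℂ | |z.im| < hs ∧ |z.re - cc| < L + hs}, ∑ i, (deriv F w i) ^ 2 = 1)
    {X : ℝ → EuclideanSpace ℝ (Fin 3)} (hX : ContDiff ℝ 1 X) (hXu : ∀ τ, ‖deriv X τ‖ = 1)
    {Rb : ℝ} (hRb0 : 0 ≤ Rb) (hRb : Rb ≤ 1 / 2) (hosc : ∀ τ σ, ‖deriv X τ - deriv X σ‖ ≤ Rb)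
    (hFX : ∀ r : ℝ, (r : ℂ) ∈ {z : ℂ | |z.im| < hs ∧ |z.re - cc| < L + hs} →
      F r = fun i => ((⟪X r, EuclideanSpace.single i (1:ℝ)⟫_ℝ : ℝ) : ℂ))
    {A : ℝ → ℝ} (hAc : Continuous A) (hA : ∀ σ, 0 ≤ A σ) (hκ : 0 ≤ κ) (hhs : 0 < hs)
    {z₀ : ℂ} (hz₀im : |z₀.im| < hs / 4) (hz₀re : |z₀.re - cc| < L + hs / 4) :
    ∃ δ : ℝ, 0 < δ ∧
      DifferentiableOn ℂ (fun z => ∫ σ in Iic (z₀.re - hs / 2),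
        (((∑ i, (F z i - ((X σ i : ℝ) : ℂ)) ^ 2) + ((κ * A σ : ℝ) : ℂ)) ^ ((3:ℂ) / 2))⁻¹ •
          ((fun i => ((deriv X σ i : ℝ) : ℂ)) ⨯₃ (fun i => F z i - ((X σ i : ℝ) : ℂ)))) (ball z₀ δ) ∧
      ∀ z ∈ ball z₀ δ,
        IntegrableOn (fun σ => (((∑ i, (F z i - ((X σ i : ℝ) : ℂ)) ^ 2) + ((κ * A σ : ℝ) : ℂ)) ^ ((3:ℂ) / 2))⁻¹ •
          ((fun i => ((deriv X σ i : ℝ) : ℂ)) ⨯₃ (fun i => F z i - ((X σ i : ℝ) : ℂ)))) (Iic (z₀.re - hs / 2)) ∧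
        IntegrableOn (fun σ => (((∑ i, (F z i - ((X σ i : ℝ) : ℂ)) ^ 2) + ((κ * A σ : ℝ) : ℂ)) ^ ((3:ℂ) / 2))⁻¹ •
          ((fun i => ((deriv X σ i : ℝ) : ℂ)) ⨯₃ (fun i => F z i - ((X σ i : ℝ) : ℂ)))) (Iic (z.re - hs / 2)) := by
  set S : Set ℂ := {z : ℂ | |z.im| < hs ∧ |z.re - cc| < L + hs} with hS
  set x₀ : ℝ := z₀.re with hx₀
  set K : ℂ → ℝ → (Fin 3 → ℂ) := fun z σ => (((∑ i, (F z i - ((X σ i : ℝ) : ℂ)) ^ 2) + ((κ * A σ : ℝ) : ℂ)) ^ ((3:ℂ) / 2))⁻¹ •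
      ((fun i => ((deriv X σ i : ℝ) : ℂ)) ⨯₃ (fun i => F z i - ((X σ i : ℝ) : ℂ))) with hK
  have hz₀S : z₀ ∈ S := ⟨by linarith, by linarith⟩
  set B : Set ℂ := {z : ℂ | |z.im| < hs / 4 ∧ |z.re - cc| < L + hs / 4} ∩ {z : ℂ | |z.im| < hs / 4 ∧ |z.re - x₀| < hs / 2}
    with hB
  have hBo : IsOpen B := (isOpen_stadium (hs / 4) (L + hs / 4) cc).inter (isOpen_stadium (hs / 4) (hs / 2) x₀)
  have hz₀B : z₀ ∈ B := ⟨⟨hz₀im, hz₀re⟩, ⟨hz₀im, by simp [hx₀, hhs]⟩⟩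
  obtain ⟨ε, hε, hεB⟩ := Metric.isOpen_iff.mp hBo z₀ hz₀B
  -- positivity at the anchor on the compact part `[x₀ − hs, x₀ − hs/2]`
  have hposA : ∀ σ ∈ Icc (x₀ - hs) (x₀ - hs / 2),
      0 < ((∑ i, (F z₀ i - ((X σ i : ℝ) : ℂ)) ^ 2) + ((κ * A σ : ℝ) : ℂ)).re := by
    intro σ hσ
    have h := quarter_foot_re_ge_left hF hM hunit hX hXu hRb0 hRb hosc hFX hhs hz₀im hz₀re (σ := σ)
      (by rw [← hx₀]; linarith [hσ.2])
    rw [Complex.add_re, Complex.ofReal_re]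
    have hp : 0 < z₀.re - σ := by rw [← hx₀]; linarith [hσ.2]
    have h2 : 0 < (z₀.re - σ) ^ 2 / 4 := by positivity
    nlinarith [mul_nonneg hκ (hA σ)]
  obtain ⟨μ, δ₁, R₁, hμ, hδ₁, -, hball₁, hmargin, -, hdiffc, -⟩ :=
    frozenRealPiece_nhds hF hM zero_le_two hX hXu hAc hz₀S (a := x₀ - hs) (b := x₀ - hs / 2) (by linarith) hposA
  obtain ⟨hdifft, -⟩ := quarter_foot_tail_left hF hM hunit hX hXu hRb0 hRb hosc hFX hAc hA hκ hhs x₀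
  set δ : ℝ := min δ₁ ε with hδ
  have hδpos : 0 < δ := lt_min hδ₁ hε
  have hV₁ : ball z₀ δ ⊆ ball z₀ δ₁ := ball_subset_ball (min_le_left _ _)
  have hVB : ball z₀ δ ⊆ B := (ball_subset_ball (min_le_right _ _)).trans hεB
  have hLor : Integrable (fun σ : ℝ => 1280 * ((1:ℝ) ^ 2 * (σ - x₀) ^ 2 + hs ^ 2)⁻¹) :=
    (integrable_lorentzian hhs one_ne_zero x₀).const_mul _
  have htailint : ∀ z ∈ B, IntegrableOn (K z) (Iic (x₀ - hs)) := by
    intro z hz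
    have hk : ∀ σ ∈ Iic (x₀ - hs), (x₀ - σ) ^ 2 / 16 ≤ ((∑ i, (F z i - ((X σ i : ℝ) : ℂ)) ^ 2) + ((κ * A σ : ℝ) : ℂ)).re ∧
        ‖K z σ‖ ≤ 1280 * ((1:ℝ) ^ 2 * (σ - x₀) ^ 2 + hs ^ 2)⁻¹ :=
      fun σ hσ => quarter_foot_kernel_le_left hF hM hunit hX hXu hRb0 hRb hosc hFX hA hκ hhs hz.1.1 hz.1.2 hz.2.2 hσ
    refine realKernel_integrableOn_of_bound hX hAc z measurableSet_Iic (fun σ hσ => ?_) hLor.integrableOn (fun σ hσ => (hk σ hσ).2)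
    have h := (hk σ hσ).1
    have hσ' : σ ≤ x₀ - hs := hσ
    have hp : 0 < x₀ - σ := by linarith
    have : 0 < (x₀ - σ) ^ 2 / 16 := by positivity
    linarith
  have hint : ∀ z ∈ ball z₀ δ, IntegrableOn (K z) (Iio (x₀ - hs)) ∧ IntegrableOn (K z) (Icc (x₀ - hs) (x₀ - hs / 2)) := by
    intro z hz
    refine ⟨(htailint z (hVB hz)).mono_set Iio_subset_Iic_self,
      realKernel_integrableOn_Icc hX hAc z fun σ hσ => lt_of_lt_of_le hμ (hmargin z (hV₁ hz) σ hσ)⟩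
  have hdifft' : DifferentiableOn ℂ (fun z => ∫ σ in Iio (x₀ - hs), K z σ) (ball z₀ δ) :=
    (hdifft.mono hVB).congr fun z _ => integral_Iio_eq_Iic (g := K z) _
  obtain ⟨hsplit, hdiff⟩ := halfline_left_glue (g := K) (V := ball z₀ δ) (by linarith : x₀ - hs ≤ x₀ - hs / 2) hint
    hdifft' (hdiffc.mono hV₁)
  refine ⟨δ, hδpos, hdiff, fun z hz => ⟨(hsplit z hz).1, ?_⟩⟩
  -- the target's own foot `Iic (Re z − hs/2)`
  have hzB := hVB hz
  have hzx : |z.re - x₀| < hs / 2 := hzB.2.2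
  have hzx' := abs_lt.mp hzx
  have hposz : ∀ σ ∈ Icc (x₀ - hs) (z.re - hs / 2),
      0 < ((∑ i, (F z i - ((X σ i : ℝ) : ℂ)) ^ 2) + ((κ * A σ : ℝ) : ℂ)).re := by
    intro σ hσ
    have h := quarter_foot_re_ge_left hF hM hunit hX hXu hRb0 hRb hosc hFX hhs hzB.1.1 hzB.1.2 (σ := σ) (by linarith [hσ.2])
    rw [Complex.add_re, Complex.ofReal_re]
    have hp : 0 < z.re - σ := by linarith [hσ.2]
    have h2 : 0 < (z.re - σ) ^ 2 / 4 := by positivity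
    nlinarith [mul_nonneg hκ (hA σ)]
  have h1 : IntegrableOn (K z) (Icc (x₀ - hs) (z.re - hs / 2)) := realKernel_integrableOn_Icc hX hAc z hposz
  have h2 : IntegrableOn (K z) (Iio (x₀ - hs)) := (htailint z hzB).mono_set Iio_subset_Iic_self
  rw [← Iio_union_Icc_eq_Iic (by linarith : x₀ - hs ≤ z.re - hs / 2)]
  exact h2.union h1

end Summit.NavierStokesRegularity.NavierStokesRegularity.Theorems.StadiumQuarterFeetFrozen

end
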